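import Literature.AlgebraicGeometry.GroupSchemes.UnitComponentBaseChange
import HarnessLib

/-!
# Crux `HLiu418` — P6 sub-line **F0-P6b ConnectedEtale**, organ stub (b1g) `stub_b1g_unitComponentBaseChange` PAID

Cell `hodgecm-mathlib`, P6 «MOD programme», sub-line `Cruxes/HLiu418/Lines/F0_P6b_ConnectedEtale.lean` (F0P6b-plan (g0); socket (b1g) «UNIT
COMPONENT BASE CHANGE» proposed by F0P6-p16 (g0) 2026-09-01 for ED. 3, text below with the line's `IsUnitComponent G G₀ j :=
IsMonHom j ∧ IsOpenImmersion j.left ∧ IsClosedImmersion j.left ∧ ConnectedSpace G₀.left` δ-UNFOLDED — nothing here imports a `Cruxes/…/Lines`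
module, and the desk's fold `stub_b1g_unitComponentBaseChange := F0P6bConnectedEtaleStubB1g.stub_b1g_unitComponentBaseChange_holds` elaborates by
`δ`).  Statement: for a local homomorphism `f : R → R′` from a HENSELIAN local ring to a local ring and a unit component `j : G₀ ↪ G` of a FINITE
group scheme `G` over `Spec R`, the base change `(Over.pullback (Spec.map f)).map j` is a unit component of `G ×_R R′` (group laws transported by
`Functor.grpObjObj`).  Proof: ★ `Literature.AlgebraicGeometry.GroupSchemes.isUnitComponent_baseChange` (organ file
`GroupSchemes/UnitComponentBaseChange.lean`, over ★ `Henselian/AugmentedLocalAlgebraBaseChange`).  HC_CM is proved only modulo the printed citations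
until rung 0 closes; nothing here is about HC — it pays one organ socket of the P6b line.

## References
* [Tate1997FiniteFlatGroupSchemes] J. Tate, *Finite flat group schemes* (1997), (3.7) (I) and Lemma 2 of its proof.
* [StacksProject] The Stacks Project, Tag 04GG.
-/

set_option linter.dupNamespace false
set_option autoImplicit false

noncomputable section

namespace Summit.HodgeConjecture.HodgeConjecture.Cruxes.HLiu418.F0P6bConnectedEtaleStubB1g

open CategoryTheory AlgebraicGeometry
open scoped MonObj

/-- **Organ stub (b1g) «unit component base change» — the text of `F0P6bConnectedEtale.stub_b1g_unitComponentBaseChange` with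
`IsUnitComponent` unfolded.**  `R` henselian local, `R′` local, `f : R → R′` local; `G, G₀` group objects of `Over (Spec R)` with `G` finite and
`j : G₀ ⟶ G` a homomorphism whose underlying map is an open and closed immersion with connected source ⇒ the same four clauses for
`(Over.pullback (Spec.map f)).map j`, the pulled-back objects carrying the transported group laws `Functor.grpObjObj`.  Proof: ★
`isUnitComponent_baseChange`. [cite: Tate1997FiniteFlatGroupSchemes, (3.7)] [cite: StacksProject, Tag 04GG] -/
theorem stub_b1g_unitComponentBaseChange_holds :
    ∀ (R : Type) [CommRing R] [HenselianLocalRing R] (R' : Type) [CommRing R'] [IsLocalRing R'] (f : R →+* R') [IsLocalHom f]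
      (G G₀ : Over (Spec (.of R))) [GrpObj G] [GrpObj G₀] (j : G₀ ⟶ G),
      IsFinite G.hom → (IsMonHom j ∧ IsOpenImmersion j.left ∧ IsClosedImmersion j.left ∧ ConnectedSpace G₀.left) →
        letI := Functor.grpObjObj (F := Over.pullback (Spec.map (CommRingCat.ofHom f))) (G := G)
        letI := Functor.grpObjObj (F := Over.pullback (Spec.map (CommRingCat.ofHom f))) (G := G₀)
        IsMonHom ((Over.pullback (Spec.map (CommRingCat.ofHom f))).map j) ∧
          IsOpenImmersion ((Over.pullback (Spec.map (CommRingCat.ofHom f))).map j).left ∧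
          IsClosedImmersion ((Over.pullback (Spec.map (CommRingCat.ofHom f))).map j).left ∧
          ConnectedSpace ↥((Over.pullback (Spec.map (CommRingCat.ofHom f))).obj G₀).left := by
  intro R _ _ R' _ _ f _ G G₀ _ _ j hG hj
  obtain ⟨h1, h2, h3, h4⟩ := hj
  haveI := hG; haveI := h1; haveI := h2; haveI := h3; haveI := h4
  exact Literature.AlgebraicGeometry.GroupSchemes.isUnitComponent_baseChange f G G₀ j

end Summit.HodgeConjecture.HodgeConjecture.Cruxes.HLiu418.F0P6bConnectedEtaleStubB1g

end
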